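import Literature.Computability.AlgebraicComplexity.SharpPBitsPPoly
import Literature.Computability.AlgebraicComplexity.CircuitConstantCount
import Literature.Computability.AlgebraicComplexity.IMMInVPProofs
import Literature.Computability.AlgebraicComplexity.ValiantKitBlocks
import Literature.LinearAlgebra.Matrix.PermanentLaplace
import HarnessLib

/-!
# Cheap permanents over small prime fields put `#P` in `FP/poly` (Bürgisser's Boolean simulation, mod `p`)

Bürgisser, *Cook's versus Valiant's hypothesis*, TCS 235 (2000), §5 (A3), p. 86, and *On defining
integers …*, ECCC TR06-113, Lemma 2.12, p. 8 ("Let `p_n` be a prime such that `n! < p_n ≤ 2^{n^{O(1)}}`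
(`p_n` is interpreted as a polynomial advice for input size `n`). On an input `A ∈ {0,1}^{n×n}`, we
execute the arithmetic circuit `C_n` in the finite field `𝔽_{p_n}`. This computation can clearly be
simulated by a Boolean circuit of polynomial size. Moreover, the result `Per(A) mod p_n` the integer
value of the permanent of `A` can be retrieved."): the PRIME-FIELD form of the transfer
"`PER` cheap ⟹ `#P ⊆ FP/poly`", with the circuits allowed to use arbitrary constants of `𝔽_p`
(they are advice).

**Theorem** (`NP_subset_PPoly_of_isPBounded_modP_perPoly`, `PSharpP_subset_PPoly_of_modP_perPoly`,
`sharpP_bitCircuits_of_modP_perPoly`): if there are p-bounded `r`, `s` such that for every `N` some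
prime `p` with `2^N < p ≤ 2^{r(N)}` has `L_{𝔽_p}(PER_N) ≤ s(N)` (fan-in-two circuits over `ZMod p`,
constants free), then every `#P` function has polynomial-size Boolean circuits for its bits, hence
`P^{#P} ⊆ P/poly` and `NP ⊆ P/poly`.

The proof is the tree's `SharpPBitsPPoly.lean` (the `ℤ mod 2^ℓ` version for constant-free circuits)
re-run modulo `p`: for `f ∈ #P`, Valiant's criterion and Bürgisser's Thm. 2.10
(`exists_countPoly`, `ArithCircuit.exists_permanent_boolSum`) give `2^K f(x) = per B(x)` with `B` an
`N × N` matrix of entries `0, ±1, x_v` or constants; PADDING `B` by an identity block to size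
`N' = CF + m + 1 > K + m` (`permanent_fromBlocks_zero₁₂`, `permanent_submatrix_equiv`) makes the
advice prime `p > 2^{N'} > 2^K f(x)`, so `per B(x) mod p` IS `2^K f(x)` and no inversion is needed;
the `𝔽_p`-circuit for `PER_{N'}` is lifted to an integer circuit with the same reduction
(`ArithCircuit.mapConsts`, `ArithCircuit.map_mapConsts_eq_self`), the entries are substituted at no
cost (`complexity_aeval_le`; constants and variables are free), and the integer circuit is
simulated modulo `p` by Boolean circuits (`cktSize_testBits_aeval_eval`,
`BurgisserBooleanPartsModPCircuits.lean`), whose output bits `K, …, K + m` are the bits of `f(x)`.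

Written for the val-lit side-sweep of the route item `GaugeDescent.ModPCollapse`
(`PrimeFieldTransfer → VP = VNP → NP ⊆ P/poly`), whose closing file is a three-line application of
`NP_subset_PPoly_of_isPBounded_modP_perPoly`.  Honest framing: Boolean bookkeeping of a conditional
transfer; VP ≠ VNP is NOT proved and nothing here is progress on it.

## References
* P. Bürgisser, *Cook's versus Valiant's hypothesis*, Theoret. Comput. Sci. 235 (2000) 71–88,
  §5 (A3), p. 86 [Burgisser2000TCS].
* P. Bürgisser, ECCC TR06-113 (2006), Lemma 2.12, p. 8 [Burgisser2006].
* S. Arora, B. Barak, *Computational Complexity* (2009), §17.2 (`NP ⊆ P^{#P}`).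
-/

noncomputable section

namespace Literature.Computability.AlgebraicComplexity

open MvPolynomial Complexity ArithCircuit CircuitArith _root_.Computability Matrix

/-! ### Small lemmas -/

/-- A `0/1` input bit as a residue modulo `p` (`p ≥ 2`, `ℓ` bits): bit `0` is the input wire, the
other bits are `0` (the mod-`p` twin of `cktSize_inputResidue'`). [folklore] -/
private theorem cktSize_inputResidue_mod {ι : Type*} {p ℓ : ℕ} [Fact (1 < p)] (v : ι) :
    CktSize B2 (fun (y : ι → Bool) => testBits ℓ (if y v then (1 : ZMod p) else 0).val) 1 := by
  have h := ((CktSize.proj B2 fun _ : Unit => v).pair (cktSize_const ι false)).outMap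
    (fun i : Fin ℓ => if i.val = 0 then Sum.inl () else Sum.inr ())
  refine (h.congr fun y i => ?_).of_le (by norm_num)
  by_cases hi : i.val = 0
  · simp only [hi, if_true, Sum.elim_inl, testBits_apply]
    cases y v
    · simp
    · simp [ZMod.val_one]
  · simp only [hi, if_false, Sum.elim_inr, testBits_apply]
    cases y v
    · simp
    · rw [if_pos rfl, ZMod.val_one, ← Nat.pow_zero 2, Nat.testBit_two_pow_of_ne (Ne.symm hi)]

/-- Padding a square matrix by an identity block does not change its permanent:
`per ((B ⊕ 1) reindexed to Fin (N + T)) = per B`. [folklore] -/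
private theorem permanent_padIdentity {R : Type*} [CommRing R] {N : ℕ} (B : Matrix (Fin N) (Fin N) R)
    (T : ℕ) :
    ((Matrix.fromBlocks B 0 0 (1 : Matrix (Fin T) (Fin T) R)).submatrix
      finSumFinEquiv.symm finSumFinEquiv.symm).permanent = B.permanent := by
  rw [permanent_submatrix_equiv, permanent_fromBlocks_zero₁₂, permanent_one, mul_one]

/-- A ring homomorphism out of `ℤ` commutes with evaluation of integer polynomials at integer
points: `φ (F(z)) = (φ_* F)(φ ∘ z)`. [folklore] -/
private theorem ringHom_eval_int {σ A : Type*} [CommRing A] (φ : ℤ →+* A) (z : σ → ℤ)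
    (F : MvPolynomial σ ℤ) : φ (eval z F) = eval (φ ∘ z) (MvPolynomial.map φ F) := by
  rw [MvPolynomial.eval_map, show eval z F = eval₂ (RingHom.id ℤ) z F from rfl,
    MvPolynomial.eval₂_comp_left, RingHom.comp_id]

/-- Substituting a matrix of entries into the generic permanent gives the permanent of the matrix
(Bürgisser 2000, (2.2)), over any commutative ring. [cite: Burgisser2000, (2.2)] -/
theorem bind₁_entries_perPoly {R : Type*} [CommRing R] {σ : Type*} {N : ℕ}
    (M : Matrix (Fin N) (Fin N) (MvPolynomial σ R)) :
    MvPolynomial.bind₁ (fun ij : Fin N × Fin N => M ij.1 ij.2) (perPoly (Fin N) R) = M.permanent := by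
  simp [perPoly, Matrix.permanent, map_sum, map_prod, Matrix.mvPolynomialX]

/-- The entries `0, ±1, X_v, C c` of the permanent form (`GoodParam`) are free for the circuit
complexity `L` with constants (inputs and constants cost nothing). [cite: Burgisser2000, Def. 2.1] -/
theorem ArithCircuit.GoodParam.complexity_eq_zero {S : Type} {s : ℕ} {a : MvPolynomial S ℤ}
    (ha : GoodParam s a) : complexity a = 0 := by
  rcases ha with rfl | rfl | rfl | ⟨v, rfl⟩ | ⟨c, rfl, -⟩
  · rw [← C_0]; exact complexity_C_holds _
  · rw [← C_1]; exact complexity_C_holds _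
  · rw [show (-1 : MvPolynomial S ℤ) = C (-1) by simp]; exact complexity_C_holds _
  · exact complexity_X_holds _
  · exact complexity_C_holds _

/-! ### The fixed-length core: bits of the certificate count by polynomial-size circuits -/

/-- **Bits of `#{y | ⟨x, y⟩ ∈ R}` by Boolean circuits, from cheap permanents over small prime
fields** (Bürgisser 2000 TCS §5 (A3) / TR06-113 Lemma 2.12 with the advice prime `p_N`): if for
every `N` some prime `p` with `2^N < p ≤ 2^{N^a + a}` has `L_{𝔽_p}(PER_N) ≤ N^b + b`, then from a
`B₂`-program of size `S` for `(x, y) ↦ [⟨x, y⟩ ∈ R]` on `{0,1}ⁿ × {0,1}^m` and any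
`CF ≥ cfBound (60 S + 1) (3 S + 2) (m + S)`, the `m + 1` bits of `x ↦ #{y ∈ {0,1}^m | ⟨x, y⟩ ∈ R}`
have `B₂`-circuits of size `((CF+m+1)^b + b + 1) · (2 + 65 ((CF+m+1)^a + a + 2)³)`.  Steps:
arithmetise (`exists_countPoly`); `2^K · count = per B` (`exists_permanent_boolSum`); pad `B` by an
identity block to size `N' = CF + m + 1` (so the advice prime `p > 2^{N'}` exceeds `2^K · count`);
lift the `𝔽_p`-circuit for `PER_{N'}` to `ℤ` (`mapConsts`), substitute the entries
(`complexity_aeval_le`), simulate modulo `p` (`cktSize_testBits_aeval_eval`) and output bits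
`K, …, K + m`. [cite: Burgisser2000TCS, §5 (A3) p. 86] -/
theorem cktSize_testBit_countWitnesses_modP {a b : ℕ}
    (hper : ∀ N : ℕ, ∃ p : ℕ, p.Prime ∧ 2 ^ N < p ∧ p ≤ 2 ^ (N ^ a + a) ∧
      complexity (perPoly (Fin N) (ZMod p)) ≤ N ^ b + b)
    (R : Language Bool) (n m S CF : ℕ)
    (hCF : cfBound (60 * S + 1) (3 * S + 2) (m + S) ≤ CF)
    (hR : CktSize B2 (fun (w : Fin n ⊕ Fin m → Bool) (_ : Unit) =>
      R.boolIndicator (boolPair (List.ofFn fun i => w (.inl i)) (List.ofFn fun j => w (.inr j)))) S) :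
    CktSize B2 (fun (x : Fin n → Bool) (i : Fin (m + 1)) => (countWitnesses R m (List.ofFn x)).testBit i)
      (((CF + m + 1) ^ b + b + 1) * (2 + 65 * ((CF + m + 1) ^ a + a + 2) ^ 3)) := by
  classical
  -- [1] the circuit for `R` on pairs
  obtain ⟨Q, hQB, hQs, hQe⟩ := hR.toCircuit
  -- [2] the counting polynomial and its constant-free circuit
  obtain ⟨G, ⟨P, hP2, hPc, hPe, hPs, hPd⟩, hG⟩ := exists_countPoly Q hQB
  -- [3] the permanent form of its Boolean sum
  obtain ⟨N, K, B, hNK, hB, hperB⟩ := ArithCircuit.exists_permanent_boolSum P hP2 hPc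
  have hPg : P.gates.length ≤ 60 * S + 1 := by unfold ArithCircuit.size at hPs; omega
  have hNKle : N + K ≤ CF := hNK.trans ((cfBound_mono hPg (hPd.trans (by omega)) (by omega)).trans hCF)
  -- the value of the Boolean sum at `x`
  set cnt : (Fin n → Bool) → ℕ := fun x =>
    (Finset.univ.filter fun y : Fin m → Bool => Q.eval (Sum.elim x y) = true).card with hcnt
  have hcnt_eq : ∀ x, countWitnesses R m (List.ofFn x) = cnt x := fun x =>
    countWitnesses_eq_card_filter R m (List.ofFn x) _ fun y => by
      rw [hQe, ← Set.mem_iff_boolIndicator]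
      simp only [Sum.elim_inl, Sum.elim_inr]
      exact Iff.rfl
  have hcnt_le : ∀ x, cnt x ≤ 2 ^ m := fun x =>
    (Finset.card_filter_le _ _).trans (by simp [Finset.card_univ])
  have heval : ∀ x : Fin n → Bool, eval (toK ℤ ∘ x) B.permanent = ((2 ^ K * cnt x : ℕ) : ℤ) := by
    intro x
    have hPe' : P.eval = G := hPe
    rw [hperB, map_mul, hPe', hG x]
    simp [hcnt]
  -- [3'] pad `B` by an identity block to size `N' = CF + m + 1`
  obtain ⟨T, hT⟩ : ∃ T, N + T = CF + m + 1 := ⟨CF + m + 1 - N, by omega⟩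
  set B' : Matrix (Fin (N + T)) (Fin (N + T)) (MvPolynomial (Fin n) ℤ) :=
    (Matrix.fromBlocks B 0 0 (1 : Matrix (Fin T) (Fin T) (MvPolynomial (Fin n) ℤ))).submatrix
      finSumFinEquiv.symm finSumFinEquiv.symm with hB'
  have hperm' : B'.permanent = B.permanent := permanent_padIdentity B T
  have hB'0 : ∀ i j, complexity (B' i j) = 0 := by
    intro i j
    simp only [hB', Matrix.submatrix_apply]
    rcases finSumFinEquiv.symm i with i' | i' <;> rcases finSumFinEquiv.symm j with j' | j'
    · simpa using (hB i' j').complexity_eq_zero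
    · simp only [Matrix.fromBlocks_apply₁₂, Matrix.zero_apply]
      rw [← C_0]; exact complexity_C_holds _
    · simp only [Matrix.fromBlocks_apply₂₁, Matrix.zero_apply]
      rw [← C_0]; exact complexity_C_holds _
    · simp only [Matrix.fromBlocks_apply₂₂]
      by_cases h : i' = j'
      · subst h
        rw [Matrix.one_apply_eq, ← C_1]
        exact complexity_C_holds _
      · rw [Matrix.one_apply_ne h, ← C_0]; exact complexity_C_holds _
  -- [4] the advice prime for `N'` and the `𝔽_p`-circuit for `PER_{N'}`, lifted to `ℤ`
  obtain ⟨p, hp, hpN, hpa, hpc⟩ := hper (N + T)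
  haveI : Fact p.Prime := ⟨hp⟩
  haveI hp1 : Fact (1 < p) := ⟨hp.one_lt⟩
  obtain ⟨P', hP'2, hP'c, hP's⟩ := exists_computes_size_eq_complexity (perPoly (Fin (N + T)) (ZMod p))
  set ψ : ℤ →+* ZMod p := Int.castRingHom (ZMod p) with hψ
  set ρ : ZMod p → ℤ := fun c => ((c.val : ℕ) : ℤ) with hρ
  have hρψ : ∀ c : ZMod p, ψ (ρ c) = c := fun c => by simp [hψ, hρ]
  set Qz : MvPolynomial (Fin (N + T) × Fin (N + T)) ℤ := (P'.mapConsts ρ).eval with hQz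
  have hQzp : MvPolynomial.map ψ Qz = perPoly (Fin (N + T)) (ZMod p) := by
    have h1 : (P'.mapConsts ρ).map ψ = P' := map_mapConsts_eq_self ρ ψ P' (fun c _ => hρψ c)
    have h2 := eval_map_apply ψ (P'.mapConsts ρ)
    rw [h1] at h2
    rw [hQz, ← h2]
    exact hP'c
  have hQzc : complexity Qz ≤ (N + T) ^ b + b := by
    refine (complexity_le_size (hP'2.mapConsts ρ) rfl).trans ?_
    rw [size_mapConsts, hP's]
    exact hpc
  -- [4'] substitute the entries of `B'`
  set Rz : MvPolynomial (Fin n) ℤ := aeval (fun ij : Fin (N + T) × Fin (N + T) => B' ij.1 ij.2) Qz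
    with hRz
  have hRzc : complexity Rz ≤ (N + T) ^ b + b := by
    refine (complexity_aeval_le _ _).trans ?_
    rw [Finset.sum_eq_zero (fun ij _ => hB'0 ij.1 ij.2), add_zero]
    exact hQzc
  have hRzp : MvPolynomial.map ψ Rz = MvPolynomial.map ψ B.permanent := by
    rw [hRz, MvPolynomial.aeval_eq_bind₁, map_bind₁, hQzp, ← hperm',
      ← Matrix.permanent_map_ringHom (MvPolynomial.map ψ) B']
    exact bind₁_entries_perPoly (B'.map (MvPolynomial.map ψ))
  -- an optimal integer circuit for `Rz`, simulated modulo `p`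
  obtain ⟨Rc, hRc2, hRcc, hRcs⟩ := exists_computes_size_eq_complexity Rz
  have hNT : N + T < (N + T) ^ a + a :=
    (Nat.pow_lt_pow_iff_right (by norm_num : 1 < 2)).1 (lt_of_lt_of_le hpN hpa)
  have hsim := cktSize_testBits_aeval_eval (p := p) (ℓ := (N + T) ^ a + a) hpa
    (fun (x : Fin n → Bool) (v : Fin n) => if x v then (1 : ZMod p) else 0)
    (fun v => cktSize_inputResidue_mod (ι := Fin n) v) Rc hRc2
  -- the simulated value is `2^K · cnt x`
  have hval : ∀ x : Fin n → Bool,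
      (aeval (fun v => if x v then (1 : ZMod p) else 0) Rc.eval).val = 2 ^ K * cnt x := by
    intro x
    have hz : (fun v => if x v then (1 : ZMod p) else 0) =
        fun v => (((toK ℤ ∘ x) v : ℤ) : ZMod p) := by
      funext v
      by_cases h : x v <;> simp [toK, h]
    have hRce' : Rc.eval = Rz := hRcc
    have hlt : 2 ^ K * cnt x < p := by
      calc 2 ^ K * cnt x ≤ 2 ^ K * 2 ^ m := Nat.mul_le_mul_left _ (hcnt_le x)
        _ = 2 ^ (K + m) := (pow_add _ _ _).symm
        _ < 2 ^ (N + T) := Nat.pow_lt_pow_right (by norm_num) (by omega)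
        _ < p := hpN
    rw [hz, hRce', aeval_intCast_point, show ((eval (toK ℤ ∘ x) Rz : ℤ) : ZMod p) =
        ψ (eval (toK ℤ ∘ x) Rz) from rfl, ringHom_eval_int, hRzp, ← ringHom_eval_int, heval x,
      hψ, map_natCast, ZMod.val_natCast_of_lt hlt]
  -- [5] output bits `K, …, K + m`
  refine ((hsim.outMap fun i : Fin (m + 1) => (⟨K + i, by omega⟩ : Fin ((N + T) ^ a + a))).congr
    fun x i => ?_).of_le ?_
  · simp only [testBits_apply]
    rw [hval x, Nat.testBit_two_pow_mul, hcnt_eq x]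
    simp
  · -- size
    rw [hT] at hRzc
    rw [hT]
    refine Nat.mul_le_mul (Nat.succ_le_succ (hRcs ▸ hRzc)) (((gateCost_le _ 1)).trans ?_)
    omega

/-! ### `#P ⊆ FP/poly`, `P^{#P} ⊆ P/poly`, `NP ⊆ P/poly` -/

/-- The size of the bit circuits is p-bounded along p-bounded certificate length `q` and
pair-circuit size `S` (with `CF = cfBound (60 S + 1) (3 S + 2) (q + S)`). [folklore] -/
private theorem isPBounded_sizeModP (a b : ℕ) {q S : ℕ → ℕ} (hq : IsPBounded q) (hS : IsPBounded S) :
    IsPBounded fun n =>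
      ((cfBound (60 * S n + 1) (3 * S n + 2) (q n + S n) + q n + 1) ^ b + b + 1) *
        (2 + 65 * ((cfBound (60 * S n + 1) (3 * S n + 2) (q n + S n) + q n + 1) ^ a + a + 2) ^ 3) := by
  have h : IsPBounded fun n => cfBound (60 * S n + 1) (3 * S n + 2) (q n + S n) :=
    isPBounded_cfBound
      (IsPBounded.add_holds (IsPBounded.mul_holds (IsPBounded.const 60) hS) (IsPBounded.const 1))
      (IsPBounded.add_holds (IsPBounded.mul_holds (IsPBounded.const 3) hS) (IsPBounded.const 2))
      (IsPBounded.add_holds hq hS)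
  have h' : IsPBounded fun n => cfBound (60 * S n + 1) (3 * S n + 2) (q n + S n) + q n + 1 :=
    IsPBounded.add_holds (IsPBounded.add_holds h hq) (IsPBounded.const 1)
  exact IsPBounded.mul_holds
    (IsPBounded.add_holds (IsPBounded.add_holds (IsPBounded.pow_holds h' b) (IsPBounded.const b))
      (IsPBounded.const 1))
    (IsPBounded.add_holds (IsPBounded.const 2)
      (IsPBounded.mul_holds (IsPBounded.const 65)
        (IsPBounded.pow_holds (IsPBounded.add_holds (IsPBounded.add_holds (IsPBounded.pow_holds h' a)
          (IsPBounded.const a)) (IsPBounded.const 2)) 3)))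

/-- **Cheap `PER` over small prime fields ⟹ `#P ⊆ FP/poly`** (Bürgisser 2000 TCS §5 (A3);
TR06-113 Lemma 2.12 with advice primes): every `#P` function has polynomial-size circuits for its
bits. [cite: Burgisser2000TCS, §5 (A3) p. 86] -/
theorem sharpP_bitCircuits_of_modP_perPoly {a b : ℕ}
    (hper : ∀ N : ℕ, ∃ p : ℕ, p.Prime ∧ 2 ^ N < p ∧ p ≤ 2 ^ (N ^ a + a) ∧
      complexity (perPoly (Fin N) (ZMod p)) ≤ N ^ b + b)
    {f : List Bool → ℕ} (hf : f ∈ SharpP) : Nonempty (BitCircuits f) := by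
  obtain ⟨R, hRP, p, hfR⟩ := hf
  obtain ⟨q, hq⟩ := exists_cktSize_boolPair_of_mem_PPoly (P_subset_PPoly_holds hRP)
  -- the certificate length and the pair-circuit size as p-bounded functions of the input length
  set pf : ℕ → ℕ := fun n => p.eval n with hpf
  set S : ℕ → ℕ := fun n => (2 * n + 2 + pf n) + q.eval (2 * n + 2 + pf n) with hS
  have hp : IsPBounded pf := (isPBounded_iff_exists_polynomial_holds pf).2 ⟨p, fun n => le_rfl⟩
  have hlin : IsPBounded fun n => 2 * n + 2 + pf n :=
    IsPBounded.add_holds (IsPBounded.add_holds (IsPBounded.mul_holds (IsPBounded.const 2) IsPBounded.id)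
      (IsPBounded.const 2)) hp
  have hq' : IsPBounded fun k => q.eval k := (isPBounded_iff_exists_polynomial_holds _).2 ⟨q, fun n => le_rfl⟩
  have hSb : IsPBounded S := IsPBounded.add_holds hlin (IsPBounded.comp_holds hq' hlin)
  obtain ⟨s, hs⟩ := (isPBounded_iff_exists_polynomial_holds _).1 (isPBounded_sizeModP a b hp hSb)
  refine ⟨{ K := p + 1, s := s, lt := fun x => ?_, ckt := fun n => ?_ }⟩
  · -- `f x ≤ 2^{p |x|} < 2^{p |x| + 1}`
    rw [hfR x, Polynomial.eval_add, Polynomial.eval_one, pow_succ]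
    have : countWitnesses R (p.eval x.length) x ≤ 2 ^ p.eval x.length := by
      classical
      unfold countWitnesses
      exact (Finset.card_filter_le _ _).trans (by simp [Finset.card_univ, card_vector])
    have h1 : 1 ≤ 2 ^ p.eval x.length := Nat.one_le_two_pow
    omega
  · have key := (cktSize_testBit_countWitnesses_modP hper R n (pf n) (S n) _ le_rfl (hq n (pf n))).of_le
      (hs n)
    have e : (p + 1).eval n = pf n + 1 := by simp [hpf]
    refine (key.outMap fun i : Fin ((p + 1).eval n) => Fin.cast e i).congr fun x i => ?_
    simp only [Fin.val_cast]
    rw [hfR, List.length_ofFn]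

/-- Hence **`P^{#P} ⊆ P/poly`** under cheap `PER` over small prime fields (the bit graph of every
`#P` function is in `P/poly`, which is closed under polynomial-time Turing reductions,
`BitGraphPPoly.lean`). [cite: Burgisser2000TCS, §5 (A3) p. 86] -/
theorem PSharpP_subset_PPoly_of_modP_perPoly {a b : ℕ}
    (hper : ∀ N : ℕ, ∃ p : ℕ, p.Prime ∧ 2 ^ N < p ∧ p ≤ 2 ^ (N ^ a + a) ∧
      complexity (perPoly (Fin N) (ZMod p)) ≤ N ^ b + b) : PSharpP ⊆ PPoly := by
  intro L hL
  obtain ⟨f, hf, hLf⟩ := Set.mem_iUnion₂.1 hL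
  obtain ⟨Bc⟩ := sharpP_bitCircuits_of_modP_perPoly hper hf
  exact Bc.PRel_ofFun_subset_PPoly_of_bitCircuits hLf

/-- Hence **`NP ⊆ P/poly`** under cheap `PER` over small prime fields (`NP ⊆ P^{#P}`,
`NP_subset_PSharpP_holds`). [cite: Burgisser2000TCS, §5 (A3) p. 86] -/
theorem NP_subset_PPoly_of_modP_perPoly {a b : ℕ}
    (hper : ∀ N : ℕ, ∃ p : ℕ, p.Prime ∧ 2 ^ N < p ∧ p ≤ 2 ^ (N ^ a + a) ∧
      complexity (perPoly (Fin N) (ZMod p)) ≤ N ^ b + b) : Nondeterministic.NP ⊆ PPoly :=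
  fun _L hL => PSharpP_subset_PPoly_of_modP_perPoly hper (NP_subset_PSharpP_holds hL)

/-- **The p-bounded form**: if there are p-bounded `r`, `s` and, for every `N`, a prime `p` with
`2^N < p ≤ 2^{r(N)}` and `L_{𝔽_p}(PER_N) ≤ s(N)` (constants of `𝔽_p` as advice), then `NP ⊆ P/poly`
(Bürgisser 2000 TCS, §5 (A3), read with advice primes as in TR06-113 Lemma 2.12). [cite: Burgisser2000TCS, §5 (A3) p. 86] -/
theorem NP_subset_PPoly_of_isPBounded_modP_perPoly {r s : ℕ → ℕ} (hr : IsPBounded r)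
    (hs : IsPBounded s)
    (hper : ∀ N : ℕ, ∃ p : ℕ, p.Prime ∧ 2 ^ N < p ∧ p ≤ 2 ^ r N ∧
      complexity (perPoly (Fin N) (ZMod p)) ≤ s N) : Nondeterministic.NP ⊆ PPoly := by
  obtain ⟨a, ha⟩ := hr
  obtain ⟨b, hb⟩ := hs
  refine NP_subset_PPoly_of_modP_perPoly (a := a) (b := b) fun N => ?_
  obtain ⟨p, hp, h1, h2, h3⟩ := hper N
  exact ⟨p, hp, h1, h2.trans (Nat.pow_le_pow_right (by norm_num) (ha N)), h3.trans (hb N)⟩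

end Literature.Computability.AlgebraicComplexity
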